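import Literature.AnabelianGeometry.SemiGraphs.CoveringGraphTowerIsoOver
import HarnessLib

/-!
# [SemiAnbd] Rmk 2.4.2 / Prop 3.6 (iv): the CANONICAL 2-cells of the second projection `ψ₀ : 𝒢'_{ψ^*S₀} → 𝒢_{S₀}` of
# the fibre square, and the base-point translation of point fibres

Mochizuki, *Semi-graphs of anabelioids*, Publ. RIMS **42** (2006), Rmk 2.4.2 p. 26 (a morphism of semi-graphs of
anabelioids consists of 1-morphisms of the constituent anabelioids AND 2-cells at the branches; the compatibility with
the branch morphisms holds only UP TO those 2-cells), Def 3.5 (i) p. 37 (the covering `𝒢_S → 𝒢` of `S ∈ B^cov(G)`),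
Prop 3.6 (iv) p. 39 («pulling back … coverings of `𝒢` to … coverings of `𝒢′`») (kurims `paper:url-f33ace170ff4`).
[cite: MochizukiSemiAnbd2006, Rmk 2.4.2 p.26]

PROOF-ONLY (cell abc-iut, layer L3, seat abc-iut-f-161 gen 10, row «(2e) (b′) PASTING BRICK», L3-lead g9 GO ε22
13:36Z; no definition, no instance, no notation, no named fact).  abc-iut-L3-t2's profinite presentations record for a
morphism `F : Hom 𝒢′ 𝒢` only the EXISTENCE of the 2-cells (`Hom.comm : ∃ g, …`); abc-iut-L3-d4's pull-back functor
`F.covPullbackWith θ` needs them as DATA `θ : F.ConjugatorFamily`, and pull-backs along different families of 2-cells of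
ONE morphism are in general not isomorphic (cell finding d4-F3, kernel witness `ProfiniteSemiGraph.not_inducesOfCompatible`).
For the second projection `ψ₀ := ψ.covPullbackSnd θ S₀ : 𝒢'_{ψ^*S₀} → 𝒢_{S₀}` of abc-iut-f-161 g8's fibre square
(`CoveringGraphPullbackSquare.lean`) this file NAMES the canonical family:
* §1 `CovObj.alignedTwoCell_mem_stab`, `CovObj.pointHVLE_brHom_coe_eq` — abc-iut-L3-t3's / abc-iut-f-161's
  `pointHom(LE)_comm` with the aligned conjugator `k` of (PS3) GIVEN: the element `γ := g_w · k · (c · b_*(g_{e′}))⁻¹`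
  stabilises the base point and conjugates the branch square (for a general point-lift morphism `X → 𝒢_S`);
* §2 ★ `Hom.exists_covPullbackSnd_conjugatorFamily` — at the branch-orbit `β′ = (b′, ω) → ν′ = (v′, o)` of `𝒢'_{ψ^*S₀}`
  the element `θ₀_{β′} := g_{ν′} · ψ_{v′}(c′) θ_{b′} · (c · (ψ b′)_*(g_{e(β′)}))⁻¹` (`g` the chosen translations into the base
  points, `c′` / `c` the incidence conjugators of `𝒢'_{ψ^*S₀}` / `𝒢_{S₀}`, `θ` the 2-cells of `ψ`) — these form a family of
  2-cells `θ₀` of `ψ₀` (`covPullback_alignedConj_conj` / `_pt`: the aligned conjugator `ψ_{v′}(c′) θ_{b′}` of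
  abc-iut-f-161's `covPullback_pointAligned`, named);
* §3 `BTemp.exists_ptFibre_post_res_iso` — for `φ : Π₁ → Π₂`, `U → X` over `X ∈ B^temp(Π₂)`, a point `x′` and `g · x′ = x₀`:
  acting by `g` is an isomorphism, in `B^temp(Stab_{Π₁}(x′))`, from the point fibre of `φ^*U → φ^*X` over `x′` onto the point
  fibre of `U → X` over `x₀` restricted along `h ↦ g φ(h) g⁻¹` (the constituent dictionary of the point lift, for the objects
  OVER the constituents); `BTemp.ρ_ρ_ρ_eq_of_eq_mul_inv` and the `toCovering` bookkeeping `CovObj.toCovering_SV_ρ_val` /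
  `_glue_val` / `_eqRec_val`.
Consumer: `CoveringGraphPullbackToCovering.lean` (same seat): under the canonical `θ₀`, pulling back along `ψ₀` commutes
with abc-iut-L3-d6's covering dictionary `toCovering`, and the tower `𝒢''_{ψ₀^*T′} → 𝒢'_{ψ^*S₀} → H` pastes to the pull-back
`𝒢'_{ψ^*S} → H` of ONE `S ∈ B^cov(K)` (Prop 4.4 (i)).  Nothing printed is asserted; no side taken on [IUTchIII] Cor. 3.12.
-/

noncomputable section

namespace Literature.AnabelianGeometry.SemiGraphs

open CategoryTheory
open Literature.AlgebraicGeometry.Frobenioids.QuasiTemperoid.BTempConnected (hom_ρ hom_ext_apply ρ_one_apply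
  ρ_mul_apply ρ_inv_apply)

universe u

namespace ProfiniteSemiGraph

/-! ## §1. The point-lift morphism under the weak stabiliser condition: the branch 2-cell NAMED -/

namespace CovObj

variable {X P : ProfiniteSemiGraph.{u}} (p : Hom X P) (S : CovObj P)
  (y : ∀ w : X.graph.Vertex, (S.SV (p.base.vertexMap w)).obj.V)
  (z : ∀ e' : X.graph.Edge, (S.SE (p.base.edgeMap e')).obj.V)
  (hglue : S.GlueCondition p.base y z) (hS : StabLE p S y z)

/-- **The explicit 2-cell of the point-lift morphism at a branch** (abc-iut-L3-t3's `pointHom_comm` / abc-iut-f-161's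
`pointHomLE_comm` with the aligned conjugator `k` of (PS3) GIVEN rather than extracted): the element
`γ := g_w · k · (c · b_*(g_{e′}))⁻¹` — `g_w`, `g_{e′}` the chosen translations into the base points, `c` the incidence
conjugator of `𝒢_S` — FIXES the base point `x_{[y_w]}` as soon as `k` carries the glued point of `z_{e(b′)}` to `y_w`.
[cite: MochizukiSemiAnbd2006, Def 3.5(i) p.37] -/
theorem alignedTwoCell_mem_stab (b' : X.graph.Branch) (w : X.graph.Vertex) (h' : X.graph.abuts b' = some w)
    (hab : S.coveringSemiGraph.abuts ((S.pointLift p.base y z hglue).branchMap b') =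
      some ((S.pointLift p.base y z hglue).vertexMap w))
    (k : P.Gv (p.base.vertexMap w))
    (hky : (S.SV (p.base.vertexMap w)).obj.ρ k
      ((S.glue (p.base.branchMap b') (p.base.vertexMap w) (p.base.abuts_branchMap b' w h')).hom.hom.hom
        (S.castPtE (p.base.edgeOf_branchMap b').symm (z (X.graph.edgeOf b')))) = y w) :
    gV p S y w * k *
        (S.conjugator hab *
          P.brHom (p.base.branchMap b') (p.base.vertexMap w) (p.base.abuts_branchMap b' w h')
            (P.castGe (p.base.edgeOf_branchMap b').symm (gE p S z (X.graph.edgeOf b'))))⁻¹ ∈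
      BTemp.stab (S.SV (p.base.vertexMap w)) (Quot.out (BTemp.cl (S.SV (p.base.vertexMap w)) (y w))) := by
  -- adapted from `CovObj.pointHom_comm` (`CoveringGraphIsoOver.lean`, same cell)
  have hcspec := S.conjugator_spec hab
  have hεz : (S.SV (p.base.vertexMap w)).obj.ρ
      (S.conjugator hab * P.brHom (p.base.branchMap b') (p.base.vertexMap w)
        (p.base.abuts_branchMap b' w h')
        (P.castGe (p.base.edgeOf_branchMap b').symm (gE p S z (X.graph.edgeOf b'))))
      ((S.glue (p.base.branchMap b') (p.base.vertexMap w) (p.base.abuts_branchMap b' w h')).hom.hom.hom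
        (S.castPtE (p.base.edgeOf_branchMap b').symm (z (X.graph.edgeOf b')))) =
      Quot.out (BTemp.cl (S.SV (p.base.vertexMap w)) (y w)) := by
    rw [ρ_mul_apply, ← glue_ρ, ← castPtE_ρ, gE_spec, ← out_cl_castPtE]
    exact hcspec
  change (S.SV (p.base.vertexMap w)).obj.ρ _ _ = _
  rw [ρ_mul_apply, ρ_mul_apply]
  nth_rewrite 1 [← hεz]
  rw [ρ_inv_apply, hky, gV_spec]

/-- **The branch square of the point-lift morphism commutes up to the NAMED stabiliser element `γ`**: if moreover
`k` conjugates `(p b′)_* ∘ p_{e′}` into `p_w ∘ b′_*` (the (PS3) alignment, `k` given), then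
`g_w p_w(b′_* x) g_w⁻¹ = γ · (c · (p b′)_*(g_{e′} p_{e′}(x) g_{e′}⁻¹) · c⁻¹) · γ⁻¹` in `Π_{P, p w}` — abc-iut-f-161's
`pointHomLE_comm` with its `∃ γ` opened. [cite: MochizukiSemiAnbd2006, Def 3.5(i) p.37] -/
theorem pointHVLE_brHom_coe_eq (b' : X.graph.Branch) (w : X.graph.Vertex) (h' : X.graph.abuts b' = some w)
    (hab : S.coveringSemiGraph.abuts ((S.pointLift p.base y z hglue).branchMap b') =
      some ((S.pointLift p.base y z hglue).vertexMap w))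
    (k : P.Gv (p.base.vertexMap w))
    (hk : ∀ x : X.Ge (X.graph.edgeOf b'),
      p.hV w (X.brHom b' w h' x) =
        k * P.brHom (p.base.branchMap b') (p.base.vertexMap w) (p.base.abuts_branchMap b' w h')
          (P.castGe (p.base.edgeOf_branchMap b').symm (p.hE (X.graph.edgeOf b') x)) * k⁻¹)
    (x : X.Ge (X.graph.edgeOf b')) :
    (pointHVLE p S y z hS w (X.brHom b' w h' x) : P.Gv (p.base.vertexMap w)) =
      gV p S y w * k *
          (S.conjugator hab *
            P.brHom (p.base.branchMap b') (p.base.vertexMap w) (p.base.abuts_branchMap b' w h')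
              (P.castGe (p.base.edgeOf_branchMap b').symm (gE p S z (X.graph.edgeOf b'))))⁻¹ *
        (S.conjugator hab *
          P.brHom (p.base.branchMap b') (p.base.vertexMap w) (p.base.abuts_branchMap b' w h')
            (P.castGe (p.base.edgeOf_branchMap b').symm
              (pointHELE p S y z hS (X.graph.edgeOf b') x : P.Ge (p.base.edgeMap (X.graph.edgeOf b')))) *
          (S.conjugator hab)⁻¹) *
        (gV p S y w * k *
          (S.conjugator hab *
            P.brHom (p.base.branchMap b') (p.base.vertexMap w) (p.base.abuts_branchMap b' w h')
              (P.castGe (p.base.edgeOf_branchMap b').symm (gE p S z (X.graph.edgeOf b'))))⁻¹)⁻¹ := by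
  -- adapted from `CovObj.pointHom_comm` (`CoveringGraphIsoOver.lean`, same cell)
  rw [pointHVLE_apply_coe, hk x, pointHELE_apply_coe, castGe_mul, castGe_mul, castGe_inv, map_mul, map_mul,
    map_inv]
  group

end CovObj

/-! ## §2. The CANONICAL 2-cells of the second projection `ψ₀ : 𝒢'_{ψ^*S₀} → 𝒢_{S₀}` -/

namespace Hom

variable {H K : ProfiniteSemiGraph.{u}} (ψ : Hom H K) (θ : ψ.ConjugatorFamily) (S₀ : CovObj K)

/-- The aligned conjugator `k := ψ_{v′}(c′) · θ_{b′}` of abc-iut-f-161's `covPullback_pointAligned` (`c′` the incidence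
conjugator of `𝒢'_{ψ^*S₀}` at the branch-orbit `β′ = (b′, ω) → ν′ = (v′, o)`, `θ_{b′}` the 2-cell of `ψ`) conjugates
`(ψ b′)_* ∘ ψ_{e′}` into `ψ_{v′} ∘ (c′ b′_* c′⁻¹)` on the stabiliser `Π_{𝒢'_{ψ^*S₀}, e(β′)} = Stab(pt ω)`.
[cite: MochizukiSemiAnbd2006, Rmk 2.4.2 p.26] -/
theorem covPullback_alignedConj_conj (β' : ((ψ.covPullbackWith θ).obj S₀).coveringSemiGraph.Branch)
    (ν' : ((ψ.covPullbackWith θ).obj S₀).coveringSemiGraph.Vertex)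
    (h' : ((ψ.covPullbackWith θ).obj S₀).coveringSemiGraph.abuts β' = some ν')
    (x : ((ψ.covPullbackWith θ).obj S₀).coveringGraph.Ge (((ψ.covPullbackWith θ).obj S₀).coveringSemiGraph.edgeOf β')) :
    ψ.hV ν'.1 ((((ψ.covPullbackWith θ).obj S₀).coveringGraph.brHom β' ν' h' x).1) =
      ψ.hV ν'.1 (((ψ.covPullbackWith θ).obj S₀).conjugator h') *
          θ.θ β'.1 ν'.1 (((ψ.covPullbackWith θ).obj S₀).abuts_of_coveringAbuts h') *
        K.brHom (ψ.base.branchMap β'.1) (ψ.base.vertexMap ν'.1)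
          (ψ.base.abuts_branchMap β'.1 ν'.1 (((ψ.covPullbackWith θ).obj S₀).abuts_of_coveringAbuts h'))
          (K.castGe (ψ.base.edgeOf_branchMap β'.1).symm (ψ.hE (H.graph.edgeOf β'.1) x.1)) *
        (ψ.hV ν'.1 (((ψ.covPullbackWith θ).obj S₀).conjugator h') *
          θ.θ β'.1 ν'.1 (((ψ.covPullbackWith θ).obj S₀).abuts_of_coveringAbuts h'))⁻¹ := by
  -- the computation of abc-iut-f-161's `covPullback_pointAligned` (`CoveringGraphPullbackSquare.lean`, same cell)
  have hb : H.graph.abuts β'.1 = some ν'.1 := ((ψ.covPullbackWith θ).obj S₀).abuts_of_coveringAbuts h'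
  show ψ.hV ν'.1 (((ψ.covPullbackWith θ).obj S₀).conjugator h' *
        H.brHom β'.1 ν'.1 hb (x : H.Ge (H.graph.edgeOf β'.1)) * (((ψ.covPullbackWith θ).obj S₀).conjugator h')⁻¹) = _
  rw [map_mul, map_mul, map_inv, θ.spec_castGe β'.1 ν'.1 hb]
  simp only [mul_assoc, mul_inv_rev]

/-- … and carries the glued point of the tautological edge point `pt ω` to the tautological vertex point `pt o`.
[cite: MochizukiSemiAnbd2006, Prop 3.6(iv) p.39] -/
theorem covPullback_alignedConj_pt (β' : ((ψ.covPullbackWith θ).obj S₀).coveringSemiGraph.Branch)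
    (ν' : ((ψ.covPullbackWith θ).obj S₀).coveringSemiGraph.Vertex)
    (h' : ((ψ.covPullbackWith θ).obj S₀).coveringSemiGraph.abuts β' = some ν') :
    (S₀.SV (ψ.base.vertexMap ν'.1)).obj.ρ
        (ψ.hV ν'.1 (((ψ.covPullbackWith θ).obj S₀).conjugator h') *
          θ.θ β'.1 ν'.1 (((ψ.covPullbackWith θ).obj S₀).abuts_of_coveringAbuts h'))
        ((S₀.glue (ψ.base.branchMap β'.1) (ψ.base.vertexMap ν'.1)
            (ψ.base.abuts_branchMap β'.1 ν'.1 (((ψ.covPullbackWith θ).obj S₀).abuts_of_coveringAbuts h'))).hom.hom.hom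
          (S₀.castPtE (ψ.base.edgeOf_branchMap β'.1).symm (Quot.out β'.2))) =
      Quot.out ν'.2 := by
  -- the computation of abc-iut-f-161's `covPullback_glueCondition` (`CoveringGraphPullbackSquare.lean`, same cell)
  obtain ⟨b', ω⟩ := β'
  obtain ⟨w, o⟩ := ν'
  have hc := ((ψ.covPullbackWith θ).obj S₀).conjugator_spec h'
  rw [covPullbackWith_glue_apply, S₀.eqRec_eq_castPtE (ψ.base.edgeOf_branchMap b')] at hc
  change (S₀.SV (ψ.base.vertexMap w)).obj.ρ (ψ.hV w (((ψ.covPullbackWith θ).obj S₀).conjugator h')) _ = _ at hc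
  rw [← ρ_mul_apply] at hc
  exact hc

/-- ★ **The CANONICAL family of 2-cells of the second projection `ψ₀ : 𝒢'_{ψ^*S₀} → 𝒢_{S₀}`** (Rmk 2.4.2: a morphism
of semi-graphs of anabelioids carries 2-cells at the branches; abc-iut-L3-t2's `Hom.comm` records only their EXISTENCE,
and pull-backs along different families of 2-cells of one morphism are in general NOT isomorphic — cell finding d4-F3,
kernel witness `ProfiniteSemiGraph.not_inducesOfCompatible`): at the branch-orbit `β′ = (b′, ω) → ν′ = (v′, o)` the element
`θ₀_{β′} := g_{ν′} · (ψ_{v′}(c′) θ_{b′}) · (c · (ψ b′)_*(g_{e(β′)}))⁻¹` of `Π_{K, ψ v′}` (`g` abc-iut-L3-t3's chosen translations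
into the base points, `c′` / `c` the incidence conjugators of `𝒢'_{ψ^*S₀}` / `𝒢_{S₀}`, `θ` the 2-cells of `ψ`; §1's aligned
2-cell `alignedTwoCell_mem_stab` for the aligned conjugator `k := ψ_{v′}(c′) θ_{b′}`) STABILISES the base point, and these
elements form a family of 2-cells for `ψ₀`.  It is THE family under which pulling back along `ψ₀` commutes with the
covering dictionary (§4). [cite: MochizukiSemiAnbd2006, Rmk 2.4.2 p.26] -/
theorem exists_covPullbackSnd_conjugatorFamily :
    ∃ θ₀ : (ψ.covPullbackSnd θ S₀).ConjugatorFamily,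
      ∀ (β' : ((ψ.covPullbackWith θ).obj S₀).coveringSemiGraph.Branch)
        (ν' : ((ψ.covPullbackWith θ).obj S₀).coveringSemiGraph.Vertex)
        (h' : ((ψ.covPullbackWith θ).obj S₀).coveringSemiGraph.abuts β' = some ν'),
        θ₀.θ β' ν' h' =
          ⟨_, CovObj.alignedTwoCell_mem_stab (((ψ.covPullbackWith θ).obj S₀).coveringHom.comp ψ) S₀
            (ψ.covPullbackPtV θ S₀) (ψ.covPullbackPtE θ S₀) (ψ.covPullback_glueCondition θ S₀) β' ν' h'
            ((ψ.covPullbackSnd θ S₀).base.abuts_branchMap β' ν' h')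
            (ψ.hV ν'.1 (((ψ.covPullbackWith θ).obj S₀).conjugator h') *
              θ.θ β'.1 ν'.1 (((ψ.covPullbackWith θ).obj S₀).abuts_of_coveringAbuts h'))
            (ψ.covPullback_alignedConj_pt θ S₀ β' ν' h')⟩ := by
  refine ⟨⟨fun β' ν' h' => ⟨_, CovObj.alignedTwoCell_mem_stab (((ψ.covPullbackWith θ).obj S₀).coveringHom.comp ψ) S₀
      (ψ.covPullbackPtV θ S₀) (ψ.covPullbackPtE θ S₀) (ψ.covPullback_glueCondition θ S₀) β' ν' h'
      ((ψ.covPullbackSnd θ S₀).base.abuts_branchMap β' ν' h')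
      (ψ.hV ν'.1 (((ψ.covPullbackWith θ).obj S₀).conjugator h') *
        θ.θ β'.1 ν'.1 (((ψ.covPullbackWith θ).obj S₀).abuts_of_coveringAbuts h'))
      (ψ.covPullback_alignedConj_pt θ S₀ β' ν' h')⟩, fun β' ν' h' x => Subtype.ext ?_⟩, fun β' ν' h' => rfl⟩
  -- both sides read in `Π_{K, ψ v′}`: the branch composite of `ψ₀` at `β′` on `x`, coerced
  have h1 : ((ψ.covPullbackSnd θ S₀).brComp β' ν' h' x).1 =
      S₀.conjugator ((ψ.covPullbackSnd θ S₀).base.abuts_branchMap β' ν' h') *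
        K.brHom ((((ψ.covPullbackWith θ).obj S₀).coveringHom.comp ψ).base.branchMap β')
          ((((ψ.covPullbackWith θ).obj S₀).coveringHom.comp ψ).base.vertexMap ν')
          ((((ψ.covPullbackWith θ).obj S₀).coveringHom.comp ψ).base.abuts_branchMap β' ν' h')
          (K.castGe ((((ψ.covPullbackWith θ).obj S₀).coveringHom.comp ψ).base.edgeOf_branchMap β').symm
            (CovObj.pointHELE (((ψ.covPullbackWith θ).obj S₀).coveringHom.comp ψ) S₀ (ψ.covPullbackPtV θ S₀)
              (ψ.covPullbackPtE θ S₀) (ψ.covPullback_stabLE θ S₀)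
              (((ψ.covPullbackWith θ).obj S₀).coveringSemiGraph.edgeOf β') x).1) *
        (S₀.conjugator ((ψ.covPullbackSnd θ S₀).base.abuts_branchMap β' ν' h'))⁻¹ := by
    change (S₀.coveringGraph.brHomAt ((ψ.covPullbackSnd θ S₀).base.branchMap β')
      ((ψ.covPullbackSnd θ S₀).base.vertexMap ν') ((ψ.covPullbackSnd θ S₀).base.abuts_branchMap β' ν' h')
      ((ψ.covPullbackSnd θ S₀).base.edgeMap (((ψ.covPullbackWith θ).obj S₀).coveringSemiGraph.edgeOf β'))
      ((ψ.covPullbackSnd θ S₀).base.edgeOf_branchMap β')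
      ((ψ.covPullbackSnd θ S₀).hE _ x)).1 = _
    rw [brHomAt_apply, CovObj.coe_coveringGraph_brHom,
      S₀.coe_cast_coveringGraph_Ge ((ψ.covPullbackSnd θ S₀).base.edgeOf_branchMap β')]
    rfl
  rw [Subgroup.coe_mul, Subgroup.coe_mul, Subgroup.coe_inv, h1]
  exact (CovObj.pointHVLE_brHom_coe_eq (((ψ.covPullbackWith θ).obj S₀).coveringHom.comp ψ) S₀ (ψ.covPullbackPtV θ S₀)
    (ψ.covPullbackPtE θ S₀) (ψ.covPullback_glueCondition θ S₀) (ψ.covPullback_stabLE θ S₀) β' ν' h'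
    ((ψ.covPullbackSnd θ S₀).base.abuts_branchMap β' ν' h') _
    (ψ.covPullback_alignedConj_conj θ S₀ β' ν' h') x).symm

end Hom

end ProfiniteSemiGraph

/-! ## §3. Point fibres of a restricted object: translating the base point -/

namespace BTemp

variable {G₁ G₂ : Type u} [Group G₁] [TopologicalSpace G₁] [Group G₂] [TopologicalSpace G₂] [IsTopologicalGroup G₂]

/-- **Translating the base point of a point fibre across a restriction of scalars.**  For `φ : Π₁ → Π₂`, `U → X` over
`X ∈ B^temp(Π₂)`, a point `x′` of `X` (read in `φ^*X`) and `g ∈ Π₂` carrying `x′` to `x₀`: acting by `g` is an isomorphism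
of `B^temp(Stab_{Π₁}(x′))` from the point fibre of `φ^*U → φ^*X` over `x′` onto the point fibre of `U → X` over `x₀`
restricted along `h ↦ g q(h) g⁻¹` (`q` = `φ` on the stabiliser) — the constituent dictionary of abc-iut-L3-t3's point
lift (`conjInto`), at the level of the objects over the constituents (§2 p. 23 «connected components», Def 3.5 (i)).
[cite: MochizukiSemiAnbd2006, Def 3.5(i) p.37] -/
theorem exists_ptFibre_post_res_iso (φ : G₁ →ₜ* G₂) (X : BTemp G₂) (U : Over X) (x' x₀ : X.obj.V) (g : G₂)
    (hg : X.obj.ρ g x' = x₀) (q : stab ((BTemp.res φ).obj X) x' →ₜ* G₂) (hq : ∀ h, q h = φ h.1)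
    (hH : ∀ h, g * q h * g⁻¹ ∈ stab X x₀) :
    ∃ e : ptFibre ((Over.post (BTemp.res φ)).obj U) x' ≅ (BTemp.res (conjInto q g (stab X x₀) hH)).obj (ptFibre U x₀),
      (∀ t, (e.hom.hom.hom t).1 = U.left.obj.ρ g t.1) ∧ ∀ t, (e.inv.hom.hom t).1 = U.left.obj.ρ g⁻¹ t.1 := by
  have hmem : ∀ t : PtFibre ((Over.post (BTemp.res φ)).obj U) x', (U.hom.hom.hom (U.left.obj.ρ g t.1) : X.obj.V) = x₀ :=
    fun t => by rw [hom_ρ, show (U.hom.hom.hom t.1 : X.obj.V) = x' from t.2, hg]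
  let f : ptFibre ((Over.post (BTemp.res φ)).obj U) x' ⟶ (BTemp.res (conjInto q g (stab X x₀) hH)).obj (ptFibre U x₀) :=
    homOfEquivariant _ _ (fun t => ⟨U.left.obj.ρ g t.1, hmem t⟩) fun h t => Subtype.ext (by
      change U.left.obj.ρ g (U.left.obj.ρ (φ h.1) t.1) = U.left.obj.ρ (g * q h * g⁻¹) (U.left.obj.ρ g t.1)
      rw [hq, ← ρ_mul_apply, ← ρ_mul_apply, inv_mul_cancel_right])
  have hf : Function.Bijective fun t => f.hom.hom t := by
    refine ⟨fun t t' htt' => Subtype.ext ?_, fun s => ?_⟩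
    · have e := congrArg (fun s : PtFibre U x₀ => U.left.obj.ρ g⁻¹ s.1) htt'
      simp only [f, homOfEquivariant_apply, ρ_inv_apply] at e
      exact e
    · refine ⟨⟨U.left.obj.ρ g⁻¹ s.1, ?_⟩, Subtype.ext ?_⟩
      · change (U.hom.hom.hom (U.left.obj.ρ g⁻¹ s.1) : X.obj.V) = x'
        rw [hom_ρ, show (U.hom.hom.hom s.1 : X.obj.V) = x₀ from s.2, ← hg, ρ_inv_apply]
      · change U.left.obj.ρ g (U.left.obj.ρ g⁻¹ s.1) = s.1
        rw [← ρ_mul_apply, mul_inv_cancel, ρ_one_apply]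
  refine ⟨isoOfBijective f hf, fun t => rfl, fun t => ?_⟩
  have h := congrArg (fun s : PtFibre U x₀ => U.left.obj.ρ g⁻¹ s.1)
    (show f.hom.hom ((isoOfBijective f hf).inv.hom.hom t) = t from
      congrArg (fun k : (BTemp.res (conjInto q g (stab X x₀) hH)).obj (ptFibre U x₀) ⟶ _ => k.hom.hom t)
        (isoOfBijective f hf).inv_hom_id)
  simp only [f, homOfEquivariant_apply, ρ_inv_apply] at h
  exact h

variable {G : Type u} [Group G] [TopologicalSpace G]

/-- Three translations against two: `a · b · c · s = d · e · s` as soon as `a = d e (b c)⁻¹` (bookkeeping for the gluing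
computation of `CoveringGraphPullbackToCovering.lean`). [cite: MochizukiSemiAnbd2006, §3 p.33] -/
theorem ρ_ρ_ρ_eq_of_eq_mul_inv (X : BTemp G) {a b c d e : G} (h : a = d * e * (b * c)⁻¹) (s : X.obj.V) :
    X.obj.ρ a (X.obj.ρ b (X.obj.ρ c s)) = X.obj.ρ d (X.obj.ρ e s) := by
  subst h
  rw [← ρ_mul_apply, ← ρ_mul_apply, ← ρ_mul_apply]
  exact congrArg (fun g => X.obj.ρ g s) (by group)

end BTemp

/-! ## §3b. Bookkeeping: the objects `toCovering T` on underlying points of `T` -/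

namespace ProfiniteSemiGraph

namespace CovObj

variable {𝒢 : ProfiniteSemiGraph.{u}} (S : CovObj 𝒢) (T : Over S)

/-- The action on a vertex object of `toCovering T`, on underlying points of `T`. [cite: MochizukiSemiAnbd2006, Prop 3.6(v) p.39] -/
theorem toCovering_SV_ρ_val (ν : S.coveringSemiGraph.Vertex) (g : S.coveringGraph.Gv ν)
    (t : ((S.toCovering.obj T).SV ν).obj.V) :
    (((S.toCovering.obj T).SV ν).obj.ρ g t).1 = (T.left.SV ν.1).obj.ρ g.1 t.1 :=
  rfl

/-- The gluing of `toCovering T` along a branch-orbit, on underlying points of `T`: the gluing of `T` then the incidence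
conjugator (abc-iut-L3-d6's `toCoveringGlue_apply`). [cite: MochizukiSemiAnbd2006, Prop 3.6(v) p.39] -/
theorem toCovering_glue_val {β : S.coveringSemiGraph.Branch} {ν : S.coveringSemiGraph.Vertex}
    (h : S.coveringSemiGraph.abuts β = some ν) (t : ((S.toCovering.obj T).SE (S.coveringSemiGraph.edgeOf β)).obj.V) :
    ((((S.toCovering.obj T).glue β ν h).hom.hom.hom t).1 : (T.left.SV ν.1).obj.V) =
      (T.left.SV ν.1).obj.ρ (S.conjugator h) ((T.left.glue β.1 ν.1 (S.abuts_of_coveringAbuts h)).hom.hom.hom t.1) :=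
  rfl

/-- Transport bookkeeping: a point of an edge object of `toCovering T` transported along an equality of edges of the
covering semi-graph has, as underlying point of `T`, the `castPtE`-transport. [cite: MochizukiSemiAnbd2006, Def 3.5(i) p.37] -/
theorem toCovering_eqRec_val {ε₁ ε₂ : S.coveringSemiGraph.Edge} (h : ε₁ = ε₂) (t : ((S.toCovering.obj T).SE ε₂).obj.V) :
    (h ▸ t : ((S.toCovering.obj T).SE ε₁).obj.V).1 = T.left.castPtE (congrArg Sigma.fst h).symm t.1 := by
  subst h; rfl

end CovObj

end ProfiniteSemiGraph

end Literature.AnabelianGeometry.SemiGraphs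

end
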